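import Mathlib
import Literature.NumberTheory.Transcendental.GammaIsoCross
import Summits.Schanuel.Schanuel.Theorems.RigidCoreAclSubsetLogFreeCoreDoubleModelTransport

/-!
# Embedding a finitely generated partial E-subfield of `ℂ` into an exponential field

Support file for stub `stub_doubleModel` of line `eac-extends-core-automorphisms` (crux
`RigidCore.AclSubsetLogFreeCore`, stmt-Schanuel-0968).  Setting: a subfield `F ⊆ ℂ`, a
`ℚ`-subspace `Ω = ℚτ + ℚg ≤ F` on which `exp` takes values in `F` (recorded by a map
`exF : F → F` with `exF = exp` on `Ω`), and a field embedding `φ : F →+* M` into an exponential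
field `M` with `exp (φ x) = φ (exF x)` on `Ω` (in the application, `φ = ιM ∘ jᵢ` for Bays–Kirby's
countable model `ιM : K →+* M` over the double `j₁, j₂ : F →+* K` of stub `stub_doubleBase`).
We construct

* `exists_baseIso`: the isomorphism `σ₀ : ℚ(gens ℚ·φτ) ≃ ℚ(gens ℚ·τ)` of base Γ-fields inverse
  to `φ` (both are images of the subfield of `F` generated by `ℚτ ∪ exp ℚτ`);
* `isEBaseIso₂_of_base`: `σ₀` is an isomorphism of base Γ-fields (`GammaField.IsEBaseIso₂`);
* `isGammaIsoTw₂_of_embedding`: `φ ∘ g ↦ g` is a cross Γ-isomorphism over `σ₀`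
  (`GammaField.isGammaIsoTw₂_of_ringHom` applied to the inverse of `φ` on the Γ-field of
  `φ(Ω)`, which is the image of the subfield of `F` generated by `Ω ∪ exp Ω`).

Everything is elementary and fully proved. [folklore]
-/

noncomputable section

-- `Summit.Schanuel.Schanuel.…` is the single-problem-summit namespace by design (D-0017).
set_option linter.dupNamespace false

open Set
open Literature.ModelTheory.ExponentialFields Literature.ModelTheory.ExponentialFields.ExponentialRing
open Literature.NumberTheory.Transcendental Literature.NumberTheory.Transcendental.GammaField

namespace Summit.Schanuel.Schanuel.Theorems.RigidCore

variable {F : IntermediateField ℚ ℂ}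
variable {M : Type} [Field M] [CharZero M] [ExponentialRing M]

/-- `ℚ`-linear images of `ℚτ`: `φ(ℚτ) = ℚ φ(τ)`. [folklore] -/
theorem map_span_singleton_eq {A E : Type*} [DivisionRing A] [CharZero A] [DivisionRing E]
    [CharZero E] (φ : A →+* E) (τF : A) :
    (Submodule.span ℚ ({τF} : Set A)).map φ.toAddMonoidHom.toRatLinearMap =
      Submodule.span ℚ ({φ τF} : Set E) := by
  rw [Submodule.map_span, image_singleton]
  rfl

/-- `ℚ`-linear images of `ℚτ + ℚg`: `φ(ℚτ + ℚg) = ℚ φ(τ) + ℚ φ(g)`. [folklore] -/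
theorem map_span_sup_span_eq {A E : Type*} [DivisionRing A] [CharZero A] [DivisionRing E]
    [CharZero E] (φ : A →+* E) (τF : A) {n : ℕ} (g : Fin n → A) :
    (Submodule.span ℚ ({τF} : Set A) ⊔ Submodule.span ℚ (range g)).map
        φ.toAddMonoidHom.toRatLinearMap =
      Submodule.span ℚ ({φ τF} : Set E) ⊔ Submodule.span ℚ (range fun i => φ (g i)) := by
  rw [Submodule.map_sup, map_span_singleton_eq, Submodule.map_span, ← range_comp]
  rfl

/-- Composite images: `ι(φ Λ) = (ι ∘ φ) Λ`. [folklore] -/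
theorem map_map_eq_map_comp {A B E : Type*} [DivisionRing A] [CharZero A] [DivisionRing B]
    [CharZero B] [DivisionRing E] [CharZero E] (φ : A →+* B) (ι : B →+* E) (Λ : Submodule ℚ A) :
    (Λ.map φ.toAddMonoidHom.toRatLinearMap).map ι.toAddMonoidHom.toRatLinearMap =
      Λ.map (ι.comp φ).toAddMonoidHom.toRatLinearMap := by
  rw [← Submodule.map_comp]
  rfl

/-- The Γ-subfield of `ℚ·φτ` consists of images of elements of the subfield of `F` generated by
`ℚτ ∪ exp ℚτ`. [folklore] -/
theorem exists_mem_closure_of_mem_fieldOf {E : Type*} [Field E] [CharZero E] [ExponentialRing E]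
    (φ : F →+* E) {exF : F → F} {Ω : Submodule ℚ F}
    (hφ : ∀ x ∈ Ω, exp (φ x) = φ (exF x)) {y : E}
    (hy : y ∈ fieldOf (Ω.map φ.toAddMonoidHom.toRatLinearMap)) :
    ∃ r ∈ Subfield.closure ((Ω : Set F) ∪ exF '' Ω), φ r = y :=
  (mem_fieldOf_map_iff φ _ (fun _ => rfl) exF hφ).1 hy

/-- Conversely, images of that subfield lie in the Γ-subfield. [folklore] -/
theorem apply_mem_fieldOf_map {E : Type*} [Field E] [CharZero E] [ExponentialRing E]
    (φ : F →+* E) {exF : F → F} {Ω : Submodule ℚ F}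
    (hφ : ∀ x ∈ Ω, exp (φ x) = φ (exF x)) {r : F}
    (hr : r ∈ Subfield.closure ((Ω : Set F) ∪ exF '' Ω)) :
    φ r ∈ fieldOf (Ω.map φ.toAddMonoidHom.toRatLinearMap) :=
  (mem_fieldOf_map_iff φ _ (fun _ => rfl) exF hφ).2 ⟨r, hr, rfl⟩

/-- On `ℂ`: `exp ↑x = ↑(exF x)` for `x ∈ Ω`, in the form consumed by the transport lemmas.
[folklore] -/
theorem exp_algebraMap_eq {exF : F → F} {Ω : Submodule ℚ F}
    (hexF : ∀ x ∈ Ω, ((exF x : F) : ℂ) = Complex.exp x) :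
    ∀ x ∈ Ω, exp (algebraMap F ℂ x) = algebraMap F ℂ (exF x) := fun x hx =>
  (hexF x hx).symm

/-- **The base isomorphism.** For `φ : F →+* M` intertwining `exp` on `ℚτ`, there is a ring
isomorphism `σ₀ : ℚ(gens ℚ·τ₁) ≃ ℚ(gens ℚ·τ)` (`τ₁ = φ τ`) with `σ₀ (φ r) = r` on the subfield of
`F` generated by `ℚτ ∪ exp ℚτ`. [folklore] -/
theorem exists_baseIso (φ : F →+* M) {exF : F → F} (τF : F)
    (hexF : ∀ x ∈ Submodule.span ℚ ({τF} : Set F), ((exF x : F) : ℂ) = Complex.exp x)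
    (hφ : ∀ x ∈ Submodule.span ℚ ({τF} : Set F), exp (φ x) = φ (exF x))
    {τ₁ : M} (hτ₁ : φ τF = τ₁) :
    ∃ σ₀ : fieldOf (Submodule.span ℚ ({τ₁} : Set M)) ≃+*
        fieldOf (Submodule.span ℚ ({(τF : ℂ)} : Set ℂ)),
      ∀ r ∈ Subfield.closure ((Submodule.span ℚ ({τF} : Set F) : Set F) ∪
          exF '' (Submodule.span ℚ ({τF} : Set F) : Set F)),
        ∀ h h', σ₀ ⟨φ r, h⟩ = ⟨(r : ℂ), h'⟩ := by
  subst hτ₁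
  set B := Submodule.span ℚ ({τF} : Set F) with hB
  set R := Subfield.closure ((B : Set F) ∪ exF '' B) with hR
  have hφC := exp_algebraMap_eq hexF
  -- membership in the two Γ-subfields
  have hmemM : ∀ r : R, φ r ∈ fieldOf (Submodule.span ℚ ({φ τF} : Set M)) := fun r => by
    rw [← map_span_singleton_eq φ τF]
    exact apply_mem_fieldOf_map φ hφ r.2
  have hmemC : ∀ r : R, algebraMap F ℂ r ∈ fieldOf (Submodule.span ℚ ({(τF : ℂ)} : Set ℂ)) :=
    fun r => by
    rw [show (τF : ℂ) = algebraMap F ℂ τF from rfl, ← map_span_singleton_eq (algebraMap F ℂ) τF]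
    exact apply_mem_fieldOf_map (algebraMap F ℂ) hφC r.2
  let ψM : R →+* fieldOf (Submodule.span ℚ ({φ τF} : Set M)) :=
    (φ.comp R.subtype).codRestrict _ hmemM
  let ψC : R →+* fieldOf (Submodule.span ℚ ({(τF : ℂ)} : Set ℂ)) :=
    ((algebraMap F ℂ).comp R.subtype).codRestrict _ hmemC
  have hbijM : Function.Bijective ψM := by
    refine ⟨fun a b h => (φ.comp R.subtype).injective (congrArg Subtype.val h), fun y => ?_⟩
    have hy : (y : M) ∈ fieldOf (B.map φ.toAddMonoidHom.toRatLinearMap) := by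
      rw [map_span_singleton_eq]; exact y.2
    obtain ⟨r, hr, hry⟩ := exists_mem_closure_of_mem_fieldOf φ hφ hy
    exact ⟨⟨r, hr⟩, Subtype.ext hry⟩
  have hbijC : Function.Bijective ψC := by
    refine ⟨fun a b h => ?_, fun y => ?_⟩
    · have h' := congrArg Subtype.val h
      exact Subtype.ext (Subtype.ext h')
    have hy : (y : ℂ) ∈ fieldOf (B.map (algebraMap F ℂ).toAddMonoidHom.toRatLinearMap) := by
      rw [map_span_singleton_eq]; exact y.2
    obtain ⟨r, hr, hry⟩ := exists_mem_closure_of_mem_fieldOf (algebraMap F ℂ) hφC hy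
    exact ⟨⟨r, hr⟩, Subtype.ext hry⟩
  refine ⟨(RingEquiv.ofBijective ψM hbijM).symm.trans (RingEquiv.ofBijective ψC hbijC),
    fun r hr h h' => ?_⟩
  have e1 : (⟨φ r, h⟩ : fieldOf (Submodule.span ℚ ({φ τF} : Set M))) =
      RingEquiv.ofBijective ψM hbijM ⟨r, hr⟩ := Subtype.ext rfl
  rw [RingEquiv.trans_apply, e1, RingEquiv.symm_apply_apply]
  exact Subtype.ext rfl

/-- **`σ₀` is an isomorphism of base Γ-fields** `ℚ·τ₁ ↝ ℚ·τ`. [folklore] -/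
theorem isEBaseIso₂_of_base {φ : F →+* M} {exF : F → F} {τF : F}
    (hexF : ∀ x ∈ Submodule.span ℚ ({τF} : Set F), ((exF x : F) : ℂ) = Complex.exp x)
    (hφ : ∀ x ∈ Submodule.span ℚ ({τF} : Set F), exp (φ x) = φ (exF x))
    {τ₁ : M} (hτ₁ : φ τF = τ₁)
    (σ₀ : fieldOf (Submodule.span ℚ ({τ₁} : Set M)) ≃+*
      fieldOf (Submodule.span ℚ ({(τF : ℂ)} : Set ℂ)))
    (hσ₀ : ∀ r ∈ Subfield.closure ((Submodule.span ℚ ({τF} : Set F) : Set F) ∪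
        exF '' (Submodule.span ℚ ({τF} : Set F) : Set F)),
      ∀ h h', σ₀ ⟨φ r, h⟩ = ⟨(r : ℂ), h'⟩) :
    IsEBaseIso₂ (Submodule.span ℚ ({τ₁} : Set M)) (Submodule.span ℚ ({(τF : ℂ)} : Set ℂ)) σ₀ := by
  subst hτ₁
  set B := Submodule.span ℚ ({τF} : Set F) with hB
  set R := Subfield.closure ((B : Set F) ∪ exF '' B) with hR
  have hBR : ∀ q : ℚ, q • τF ∈ B := fun q =>
    Submodule.smul_mem _ _ (Submodule.mem_span_singleton_self τF)
  have hR₁ : ∀ q : ℚ, q • τF ∈ R := fun q => Subfield.subset_closure (Or.inl (hBR q))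
  have hR₂ : ∀ q : ℚ, exF (q • τF) ∈ R := fun q =>
    Subfield.subset_closure (Or.inr ⟨_, hBR q, rfl⟩)
  have hφq : ∀ q : ℚ, φ (q • τF) = q • φ τF := fun q => map_rat_smul φ q τF
  have hCq : ∀ q : ℚ, ((q • τF : F) : ℂ) = q • (τF : ℂ) := fun q => rfl
  refine ⟨fun {x} hx => ?_, fun {y} hy => ?_, fun {x} hx => ?_⟩
  · obtain ⟨q, rfl⟩ := Submodule.mem_span_singleton.1 hx
    have h1 : φ (q • τF) ∈ fieldOf (Submodule.span ℚ ({φ τF} : Set M)) := by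
      rw [hφq]; exact mem_fieldOf_of_mem hx
    have e : (⟨q • φ τF, mem_fieldOf_of_mem hx⟩ : fieldOf (Submodule.span ℚ ({φ τF} : Set M))) =
        ⟨φ (q • τF), h1⟩ := Subtype.ext (hφq q).symm
    rw [e, hσ₀ _ (hR₁ q) h1 (mem_fieldOf_of_mem (by
      rw [hCq]; exact Submodule.smul_mem _ _ (Submodule.mem_span_singleton_self _)))]
    change ((q • τF : F) : ℂ) ∈ _
    rw [hCq]
    exact Submodule.smul_mem _ _ (Submodule.mem_span_singleton_self _)
  · obtain ⟨q, rfl⟩ := Submodule.mem_span_singleton.1 hy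
    have h1 : φ (q • τF) ∈ fieldOf (Submodule.span ℚ ({φ τF} : Set M)) := by
      rw [hφq]; exact mem_fieldOf_of_mem (Submodule.smul_mem _ _ (Submodule.mem_span_singleton_self _))
    have e : (⟨q • (τF : ℂ), mem_fieldOf_of_mem hy⟩ :
        fieldOf (Submodule.span ℚ ({(τF : ℂ)} : Set ℂ))) = σ₀ ⟨φ (q • τF), h1⟩ :=
      (hσ₀ _ (hR₁ q) h1 _).symm
    rw [e, RingEquiv.symm_apply_apply]
    change φ (q • τF) ∈ _
    rw [hφq]
    exact Submodule.smul_mem _ _ (Submodule.mem_span_singleton_self _)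
  · obtain ⟨q, rfl⟩ := Submodule.mem_span_singleton.1 hx
    have hx' : q • φ τF ∈ Submodule.span ℚ ({φ τF} : Set M) := hx
    have h1 : φ (q • τF) ∈ fieldOf (Submodule.span ℚ ({φ τF} : Set M)) := by
      rw [hφq]; exact mem_fieldOf_of_mem hx
    have h2 : φ (exF (q • τF)) ∈ fieldOf (Submodule.span ℚ ({φ τF} : Set M)) := by
      rw [← hφ _ (hBR q), hφq]; exact exp_mem_fieldOf hx
    have e1 : (⟨q • φ τF, mem_fieldOf_of_mem hx⟩ : fieldOf (Submodule.span ℚ ({φ τF} : Set M))) =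
        ⟨φ (q • τF), h1⟩ := Subtype.ext (hφq q).symm
    have e2 : (⟨exp (q • φ τF), exp_mem_fieldOf hx⟩ :
        fieldOf (Submodule.span ℚ ({φ τF} : Set M))) = ⟨φ (exF (q • τF)), h2⟩ :=
      Subtype.ext (by change exp (q • φ τF) = φ (exF (q • τF)); rw [← hφq, hφ _ (hBR q)])
    have hm1 : ((q • τF : F) : ℂ) ∈ fieldOf (Submodule.span ℚ ({(τF : ℂ)} : Set ℂ)) :=
      mem_fieldOf_of_mem (by rw [hCq]; exact Submodule.smul_mem _ _ (Submodule.mem_span_singleton_self _))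
    have hm2 : ((exF (q • τF) : F) : ℂ) ∈ fieldOf (Submodule.span ℚ ({(τF : ℂ)} : Set ℂ)) := by
      rw [hexF _ (hBR q)]
      exact exp_mem_fieldOf (by
        rw [hCq]; exact Submodule.smul_mem _ _ (Submodule.mem_span_singleton_self _))
    rw [e1, e2, hσ₀ _ (hR₁ q) h1 hm1, hσ₀ _ (hR₂ q) h2 hm2]
    exact hexF _ (hBR q)

/-- **`φ ∘ g ↦ g` is a cross Γ-isomorphism over `σ₀`.** For `φ : F →+* M` intertwining `exp`
on `Ω = ℚτ + ℚg` and `σ₀` inverse to `φ` on the base Γ-field, the inverse of `φ` on the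
Γ-field of `φ(Ω)` is a field embedding into `ℂ` extending `σ₀`, sending `φ gᵢ ↦ gᵢ` and
commuting with `exp` on `φ(Ω)`; by `GammaField.isGammaIsoTw₂_of_ringHom` this is a cross
Γ-isomorphism (Bays–Kirby 2018, Def. 3.10). [cite: BaysKirby2018ANT, Def. 3.10] -/
theorem isGammaIsoTw₂_of_embedding (φ : F →+* M) {exF : F → F} {τF : F} {n : ℕ} (g : Fin n → F)
    (hexF : ∀ x ∈ Submodule.span ℚ ({τF} : Set F) ⊔ Submodule.span ℚ (range g),
      ((exF x : F) : ℂ) = Complex.exp x)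
    (hφ : ∀ x ∈ Submodule.span ℚ ({τF} : Set F) ⊔ Submodule.span ℚ (range g),
      exp (φ x) = φ (exF x))
    {τ₁ : M} (hτ₁ : φ τF = τ₁)
    (σ₀ : fieldOf (Submodule.span ℚ ({τ₁} : Set M)) ≃+*
      fieldOf (Submodule.span ℚ ({(τF : ℂ)} : Set ℂ)))
    (hσ₀ : ∀ r ∈ Subfield.closure ((Submodule.span ℚ ({τF} : Set F) : Set F) ∪
        exF '' (Submodule.span ℚ ({τF} : Set F) : Set F)),
      ∀ h h', σ₀ ⟨φ r, h⟩ = ⟨(r : ℂ), h'⟩) :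
    IsGammaIsoTw₂ σ₀ (fun i => φ (g i)) (fun i => (g i : ℂ)) := by
  subst hτ₁
  -- notation-free abbreviations, as propositions
  have hBΩ : Submodule.span ℚ ({τF} : Set F) ≤
      Submodule.span ℚ ({τF} : Set F) ⊔ Submodule.span ℚ (range g) := le_sup_left
  have hRB : Subfield.closure ((Submodule.span ℚ ({τF} : Set F) : Set F) ∪
        exF '' (Submodule.span ℚ ({τF} : Set F) : Set F)) ≤
      Subfield.closure (((Submodule.span ℚ ({τF} : Set F) ⊔ Submodule.span ℚ (range g) :
          Submodule ℚ F) : Set F) ∪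
        exF '' ((Submodule.span ℚ ({τF} : Set F) ⊔ Submodule.span ℚ (range g) :
          Submodule ℚ F) : Set F)) :=
    Subfield.closure_mono (union_subset_union (fun x hx => hBΩ hx)
      (image_mono fun x hx => hBΩ hx))
  have hφB : ∀ x ∈ Submodule.span ℚ ({τF} : Set F), exp (φ x) = φ (exF x) := fun x hx =>
    hφ x (hBΩ hx)
  have hexB : ∀ x ∈ Submodule.span ℚ ({τF} : Set F), ((exF x : F) : ℂ) = Complex.exp x :=
    fun x hx => hexF x (hBΩ hx)
  have hΩφ := map_span_sup_span_eq φ τF g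
  -- elements of the generated field `E₁ ⊆ M` come from `R ⊆ F`
  have hE₁R : ∀ y ∈ IntermediateField.adjoin (fieldOf (Submodule.span ℚ ({φ τF} : Set M)))
      (allGens fun i => φ (g i)),
      ∃ r ∈ Subfield.closure (((Submodule.span ℚ ({τF} : Set F) ⊔ Submodule.span ℚ (range g) :
          Submodule ℚ F) : Set F) ∪
        exF '' ((Submodule.span ℚ ({τF} : Set F) ⊔ Submodule.span ℚ (range g) :
          Submodule ℚ F) : Set F)), φ r = y := by
    intro y hy
    rw [mem_adjoinField_allGens_iff, ← hΩφ] at hy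
    exact exists_mem_closure_of_mem_fieldOf φ hφ hy
  have hRE₁ : ∀ r : Subfield.closure (((Submodule.span ℚ ({τF} : Set F) ⊔
        Submodule.span ℚ (range g) : Submodule ℚ F) : Set F) ∪
        exF '' ((Submodule.span ℚ ({τF} : Set F) ⊔ Submodule.span ℚ (range g) :
          Submodule ℚ F) : Set F)),
      φ r ∈ IntermediateField.adjoin (fieldOf (Submodule.span ℚ ({φ τF} : Set M)))
        (allGens fun i => φ (g i)) := fun r => by
    rw [mem_adjoinField_allGens_iff, ← hΩφ]
    exact apply_mem_fieldOf_map φ hφ r.2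
  let ψ : Subfield.closure (((Submodule.span ℚ ({τF} : Set F) ⊔
        Submodule.span ℚ (range g) : Submodule ℚ F) : Set F) ∪
        exF '' ((Submodule.span ℚ ({τF} : Set F) ⊔ Submodule.span ℚ (range g) :
          Submodule ℚ F) : Set F)) →+*
      IntermediateField.adjoin (fieldOf (Submodule.span ℚ ({φ τF} : Set M)))
        (allGens fun i => φ (g i)) :=
    (φ.comp (Subfield.subtype _)).codRestrict _ hRE₁
  have hbij : Function.Bijective ψ := by
    refine ⟨fun a b h => ?_, fun y => ?_⟩
    · have h' := congrArg Subtype.val h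
      exact (φ.comp (Subfield.subtype _)).injective h'
    · obtain ⟨r, hr, hry⟩ := hE₁R y y.2
      exact ⟨⟨r, hr⟩, Subtype.ext hry⟩
  let Θ : IntermediateField.adjoin (fieldOf (Submodule.span ℚ ({φ τF} : Set M)))
      (allGens fun i => φ (g i)) →+* ℂ :=
    ((algebraMap F ℂ).comp (Subfield.subtype _)).comp (RingEquiv.ofBijective ψ hbij).symm.toRingHom
  have hΘ : ∀ (r : F) (hr : r ∈ Subfield.closure (((Submodule.span ℚ ({τF} : Set F) ⊔
        Submodule.span ℚ (range g) : Submodule ℚ F) : Set F) ∪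
        exF '' ((Submodule.span ℚ ({τF} : Set F) ⊔ Submodule.span ℚ (range g) :
          Submodule ℚ F) : Set F)))
      (h : φ r ∈ IntermediateField.adjoin (fieldOf (Submodule.span ℚ ({φ τF} : Set M)))
        (allGens fun i => φ (g i))), Θ ⟨φ r, h⟩ = (r : ℂ) := by
    intro r hr h
    have e1 : (⟨φ r, h⟩ : IntermediateField.adjoin (fieldOf (Submodule.span ℚ ({φ τF} : Set M)))
        (allGens fun i => φ (g i))) = RingEquiv.ofBijective ψ hbij ⟨r, hr⟩ := Subtype.ext rfl
    change algebraMap F ℂ (Subfield.subtype _ ((RingEquiv.ofBijective ψ hbij).symm ⟨φ r, h⟩)) = r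
    rw [e1, RingEquiv.symm_apply_apply]
    rfl
  refine isGammaIsoTw₂_of_ringHom Θ (fun k => ?_) (fun i => ?_) (fun x hx => ?_)
  · -- `Θ` is `σ₀` on the base Γ-field
    obtain ⟨k, hk⟩ := k
    have hk' : k ∈ fieldOf ((Submodule.span ℚ ({τF} : Set F)).map
        φ.toAddMonoidHom.toRatLinearMap) := by
      rw [map_span_singleton_eq]; exact hk
    obtain ⟨r₀, hr₀, rfl⟩ := exists_mem_closure_of_mem_fieldOf φ hφB hk'
    have hm : (r₀ : ℂ) ∈ fieldOf (Submodule.span ℚ ({(τF : ℂ)} : Set ℂ)) := by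
      have := apply_mem_fieldOf_map (algebraMap F ℂ) (exp_algebraMap_eq hexB) hr₀
      rw [map_span_singleton_eq] at this
      exact this
    rw [hΘ r₀ (hRB hr₀), hσ₀ r₀ hr₀ hk hm]
  · -- `Θ (φ gᵢ) = gᵢ`
    exact hΘ (g i) (Subfield.subset_closure (Or.inl (Submodule.mem_sup_right
      (Submodule.subset_span (mem_range_self i))))) _
  · -- `Θ` commutes with `exp` on `ℚ φτ + ℚ φg = φ(Ω)`
    have hx' : x ∈ (Submodule.span ℚ ({τF} : Set F) ⊔ Submodule.span ℚ (range g)).map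
        φ.toAddMonoidHom.toRatLinearMap := by
      rw [hΩφ]; exact hx
    obtain ⟨w, hw, rfl⟩ := (mem_map_iff_of_eq φ _ (fun _ => rfl)).1 hx'
    have hwR := Subfield.subset_closure (Or.inl hw) (s := (((Submodule.span ℚ ({τF} : Set F) ⊔
        Submodule.span ℚ (range g) : Submodule ℚ F) : Set F) ∪
        exF '' ((Submodule.span ℚ ({τF} : Set F) ⊔ Submodule.span ℚ (range g) :
          Submodule ℚ F) : Set F)))
    have hewR := Subfield.subset_closure (Or.inr ⟨w, hw, rfl⟩) (s := (((Submodule.span ℚ ({τF} : Set F) ⊔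
        Submodule.span ℚ (range g) : Submodule ℚ F) : Set F) ∪
        exF '' ((Submodule.span ℚ ({τF} : Set F) ⊔ Submodule.span ℚ (range g) :
          Submodule ℚ F) : Set F)))
    have hem := hRE₁ ⟨_, hewR⟩
    have e : (⟨exp (φ w), exp_mem_adjoinField_of_mem hx⟩ :
        IntermediateField.adjoin (fieldOf (Submodule.span ℚ ({φ τF} : Set M)))
          (allGens fun i => φ (g i))) = ⟨φ (exF w), hem⟩ := Subtype.ext (hφ w hw)
    rw [e, hΘ _ hewR, hΘ _ hwR, hexF w hw]
    rfl

/-- Registered sub-goal alias (for `--supports stmt-Schanuel-0968`): `ℚ`-linear images of `ℚτ`. -/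
theorem doubleModel_map_span_singleton_eq {A E : Type*} [DivisionRing A] [CharZero A] [DivisionRing E]
    [CharZero E] (φ : A →+* E) (τF : A) :
    (Submodule.span ℚ ({τF} : Set A)).map φ.toAddMonoidHom.toRatLinearMap =
      Submodule.span ℚ ({φ τF} : Set E) :=
  map_span_singleton_eq φ τF

end Summit.Schanuel.Schanuel.Theorems.RigidCore
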